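import Literature.NumberTheory.Automorphic.TorusOrbitalDescentTwist             -- FILE A (generic layer): `lintegral_descConj_eq_mul_lintegral_prod_…_of_eq_smul_map`
import Literature.NumberTheory.Automorphic.GLnIwasawaIntegration                -- ★ `isInvInvariant_of_isMulRightInvariant`
import Literature.MeasureTheory.Group.InvariantQuotientAbelian                  -- ★ `isInvInvariant_of_comm`
import Literature.NumberTheory.Automorphic.UnitaryGroupBorelRingModulus         -- ★ `HeisRing.borelRingHomeomorph` (`T × N ≃ₜ B` on `U(σ, Φ₃)(R)`)
import Literature.NumberTheory.Automorphic.CMBorelIwahoriShellBound             -- ★ `isClosed_cmBorelTriple_M` (+ ★ `isClosed_cmBorelTriple_N`)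
import Literature.NumberTheory.Automorphic.UnitaryGroupCMLocalIwasawa           -- ★ `exists_mem_cmLocalIntegralLevel_mul_borel` (`G = K_v B`)
import Literature.NumberTheory.Automorphic.LimitCompactOpenUnimodular           -- ★ `isMulRightInvariant_cmBorelTriple_N` (`N(L⁺_v)` unimodular)
import Literature.NumberTheory.Automorphic.LocalUnitaryGroupUnimodularIsotropic -- ★ `modularCharacter_local_eq_one_of_isotropic`, `antidiagOne_isotropic` (`U(Φ₃)(L⁺_v)` unimodular)
import Literature.NumberTheory.Automorphic.ConstantTermUnitElementUnitary       -- ★ `lintegral_prod_indicator_cmLocalIntegralLevel_conj_torus_mul_unipotent` (constant term of the unit)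
import HarnessLib

/-!
# Torus descent of orbital integrals on `U(Φ₃)(L⁺_v)` at a NON-SPLIT place, hypothesis-driven in the twist of `N(L⁺_v)`

Topic `NumberTheory/Automorphic`; namespace `Literature.NumberTheory.Automorphic.UnitaryGroup`.  KERNEL mathematics only: theorems, no
definition, no named fact, no instance, no notation, no `sorry`.  Cell `pub/hodgecm-mathlib`, programme P3a, road «D-N7-inert» brick (L8b)
(map `CENSUS-DN7-inert-UnitFL-U3` §3 (L8): the Levi ∕ constant-term case of the unit fundamental lemma [Rogawski1990, Prop. 4.9.1 (b)] at a
non-split place) — FILE B, the CM dress of ★ `TorusOrbitalDescentTwist` (FILE A).  HC_CM is proved only modulo the 7 printed citations until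
rung 0 closes; this file discharges no named fact.

## The mathematics

On the CM local carrier `G_v = U(Φ₃)(L⁺_v) = ↥(unitaryGroupOfForm (c ⊗ 1) (cmLocalForm L 3 v))` (every finite place `v` of `L⁺`: inert,
ramified, split alike) with its Borel datum `T = torusU`, `N = unipotentU`, `B = borelU` (the fields of ★ `cmBorelTriple L 3 v`, `rfl`) EVERY
structural hypothesis of Gelbart's `K T N` integration formula is a theorem of the tree: `T`, `N`, `B` closed (★ `isClosed_cmBorelTriple_M ∕ _N`,
`isClosed_borelU`), `T` normalises `N` (★ `borelU_le_normalizer`), `T × N ≃ₜ B` (★ `HeisRing.borelRingHomeomorph`), `T` commutative, `N` and `G_v`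
unimodular (★ `isMulRightInvariant_cmBorelTriple_N`, ★ `modularCharacter_local_eq_one_of_isotropic`), `G_v = K_v B` (★
`exists_mem_cmLocalIntegralLevel_mul_borel`).  Hence (§2): every non-zero invariant Radon measure on `G_v ⧸ T` is
`C • ((k, n) ↦ k n T)_* (κ ⊗ μ_N)` (`exists_measure_quotient_torusU_cmLocal_eq_smul_map`, for any compact `K` with `G_v = K B`), and for
`t ∈ T(L⁺_v)` whose twist on `N(L⁺_v)` has module `J` — the ONE remaining PROPERTY binder
`hJac : ∀ Φ, ∫_N Φ(n t n⁻¹) dμ_N = J · ∫_N Φ(t n) dμ_N` on ★ `unipotentU` (for `t` regular `J = ‖D_{G∕T}(t)‖_v⁻¹`, [Rogawski1990 §7.3 p. 97;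
Lemma 4.13.1 (a)]; FILE A turns the measure form `(n ↦ t⁻¹ n⁻¹ t n)_* μ_N = J • μ_N` into it) —
**`∫_{G_v ⧸ T} F(y t y⁻¹) dμ = C · J · ∫_{K × N} F(k (t n) k⁻¹) d(κ ⊗ μ_N)`** (`lintegral_descConj_torusU_cmLocal_eq_mul_lintegral_prod`), and
with `F = 1_{K_v}` and ★ A-p06 `lintegral_prod_indicator_cmLocalIntegralLevel_conj_torus_mul_unipotent` the unit case
**`∫_{G_v ⧸ T} 1_{K_v}(y t y⁻¹) dμ = C · J · κ(K) · μ_N(N ∩ K_v) · 1_{K_v}(t)`** (`lintegral_descConj_indicator_cmLocalIntegralLevel_eq`) — the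
`G`-side of [Rogawski1990 (4.9.2)] `Φ^{T∖G}(t, 1_{K_v}) = |D(t)|^{−1∕2} (1_{K_v})^{(B)}(t)` up to the measure dictionary.  NOT here: the value of
`J` (the local Heisenberg chart, programme (L8a)), the `H`-side, transfer factors, Haar normalisations.

Instance note: the quotient is spelled `G_v ⧸ torusU σ_v J` (not `⧸ (cmBorelTriple L 3 v).M`) so that `SMul G_v (G_v ⧸ T)` synthesises within
default limits; two declarations run at `maxHeartbeats 400000` (instance-term unification on the CM carrier; < 10 s each).

## References
* [Rogawski1990] J. D. Rogawski, *Automorphic Representations of Unitary Groups in Three Variables*, Ann. of Math. Stud. 123 (1990), §1.10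
  p. 9; §4.9 Prop. 4.9.1 (b), (4.9.1)–(4.9.2) p. 55; §4.13 Lemma 4.13.1 (a) p. 64, proof p. 70; §7.3 p. 97.
* [Gelbart1975] S. Gelbart, *Automorphic Forms on Adele Groups*, Ann. of Math. Stud. 83 (1975), Thm. 9.22 (iii).
* [GetzHahn2024] J. R. Getz, H. Hahn, *An Introduction to Automorphic Representations*, GTM 300 (2024), Lemma 3.5.4, §7.5 Lemma 7.5.3.
* [PlatonovRapinchuk1994] V. Platonov, A. Rapinchuk, *Algebraic Groups and Number Theory* (1994), §3.5, §5.1.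
-/

set_option autoImplicit false

noncomputable section

open MeasureTheory Measure Set Filter Topology
open scoped ENNReal NNReal

namespace Literature.NumberTheory.Automorphic

open Literature.MeasureTheory.Group

/-! ## §2 The CM local carrier `G_v = U(Φ₃)(L⁺_v)`: every hypothesis of FILE A except the twist is a theorem of the tree

Spellings: `σ_v = conjLocal L c v`, `J = cmLocalForm L 3 v`; the Borel data are ★ `torusU ∕ unipotentU ∕ borelU σ_v J` (`=` the fields
`.M ∕ .N ∕ .P` of ★ `cmBorelTriple L 3 v` by `rfl`, ★ `borelTriple_M ∕ _N ∕ _P`; the un-projected spelling keeps instance synthesis on the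
quotient `G_v ⧸ T` within default heartbeats). -/

namespace UnitaryGroup

open _root_.NumberField _root_.IsDedekindDomain

variable (L : Type) [Field L] [NumberField L] [IsCMField L] (v : HeightOneSpectrum (𝓞 ↥(maximalRealSubfield L)))

/-- `t n t⁻¹ ∈ N(L⁺_v)` for `t ∈ T(L⁺_v)`, `n ∈ N(L⁺_v)` (★ `borelU_le_normalizer`). [cite: Rogawski1990, §1.10 p. 9] -/
theorem conj_mem_unipotentU_cmLocal {t n : ↥(unitaryGroupOfForm (conjLocal L (IsCMField.complexConj L) v) (cmLocalForm L 3 v))}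
    (ht : t ∈ torusU (conjLocal L (IsCMField.complexConj L) v) (cmLocalForm L 3 v))
    (hn : n ∈ unipotentU (conjLocal L (IsCMField.complexConj L) v) (cmLocalForm L 3 v)) :
    t * n * t⁻¹ ∈ unipotentU (conjLocal L (IsCMField.complexConj L) v) (cmLocalForm L 3 v) := by
  have h := (borelU_le_normalizer (conjLocal L (IsCMField.complexConj L) v) (cmLocalForm L 3 v)) (torusU_le_borelU _ _ ht)
  rw [Subgroup.mem_normalizer_iff] at h
  exact (h n).1 hn

/-- `t⁻¹ n t ∈ N(L⁺_v)` for `t ∈ T(L⁺_v)`, `n ∈ N(L⁺_v)`. [cite: Rogawski1990, §1.10 p. 9] -/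
theorem inv_conj_mem_unipotentU_cmLocal {t n : ↥(unitaryGroupOfForm (conjLocal L (IsCMField.complexConj L) v) (cmLocalForm L 3 v))}
    (ht : t ∈ torusU (conjLocal L (IsCMField.complexConj L) v) (cmLocalForm L 3 v))
    (hn : n ∈ unipotentU (conjLocal L (IsCMField.complexConj L) v) (cmLocalForm L 3 v)) :
    t⁻¹ * n * t ∈ unipotentU (conjLocal L (IsCMField.complexConj L) v) (cmLocalForm L 3 v) := by
  simpa only [inv_inv] using conj_mem_unipotentU_cmLocal L v (inv_mem ht) hn

/-- The diagonal torus `T(L⁺_v)` is commutative (its elements are `diag(d)`, ★ `mem_torusU_iff`; the ring-generic argument of ★ `torusU_mul_comm`).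
[cite: Rogawski1990, §1.10 p. 9] -/
theorem mul_comm_of_mem_torusU_cmLocal {t₁ t₂ : ↥(unitaryGroupOfForm (conjLocal L (IsCMField.complexConj L) v) (cmLocalForm L 3 v))}
    (h₁ : t₁ ∈ torusU (conjLocal L (IsCMField.complexConj L) v) (cmLocalForm L 3 v))
    (h₂ : t₂ ∈ torusU (conjLocal L (IsCMField.complexConj L) v) (cmLocalForm L 3 v)) : t₁ * t₂ = t₂ * t₁ := by
  obtain ⟨d₁, hd₁⟩ := (mem_torusU_iff t₁).1 h₁
  obtain ⟨d₂, hd₂⟩ := (mem_torusU_iff t₂).1 h₂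
  apply Subtype.ext
  rw [Subgroup.coe_mul, Subgroup.coe_mul, ← hd₁, ← hd₂, ← map_mul, ← map_mul, mul_comm]

/-- `T(L⁺_v)` centralises each of its elements — the `ht` binder of `descConj` for a torus element. [cite: Rogawski1990, §1.10 p. 9] -/
theorem forall_mem_torusU_cmLocal_comm {t : ↥(unitaryGroupOfForm (conjLocal L (IsCMField.complexConj L) v) (cmLocalForm L 3 v))}
    (ht : t ∈ torusU (conjLocal L (IsCMField.complexConj L) v) (cmLocalForm L 3 v)) :
    ∀ a ∈ torusU (conjLocal L (IsCMField.complexConj L) v) (cmLocalForm L 3 v), a * t = t * a :=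
  fun _ ha => mul_comm_of_mem_torusU_cmLocal L v ha ht

set_option maxHeartbeats 400000 in
/-- **`T(L⁺_v) × N(L⁺_v) ≃ₜ B(L⁺_v)`, `(t, n) ↦ t n`** — the `e ∕ he` binder of ★ `KNAQuotientIntegration` on the CM carrier (★
`HeisRing.borelRingHomeomorph` transported from the `subgroupOf` frame). [cite: Rogawski1990, §1.10 p. 9] -/
theorem exists_homeomorph_torusU_prod_unipotentU_cmLocal_eq_anMap :
    ∃ e : ↥(torusU (conjLocal L (IsCMField.complexConj L) v) (cmLocalForm L 3 v)) ×
        ↥(unipotentU (conjLocal L (IsCMField.complexConj L) v) (cmLocalForm L 3 v)) ≃ₜ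
        ↥(borelU (conjLocal L (IsCMField.complexConj L) v) (cmLocalForm L 3 v)),
      ∀ p, e p = anMap (torusU (conjLocal L (IsCMField.complexConj L) v) (cmLocalForm L 3 v))
        (unipotentU (conjLocal L (IsCMField.complexConj L) v) (cmLocalForm L 3 v))
        (borelU (conjLocal L (IsCMField.complexConj L) v) (cmLocalForm L 3 v))
        (torusU_le_borelU _ _) (unipotentU_le_borelU _ _) p := by
  obtain ⟨eT, heT⟩ : ∃ eT : ↥(torusU (conjLocal L (IsCMField.complexConj L) v) (cmLocalForm L 3 v)) ≃ₜ
      ↥((torusU (conjLocal L (IsCMField.complexConj L) v) (cmLocalForm L 3 v)).subgroupOf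
        (borelU (conjLocal L (IsCMField.complexConj L) v) (cmLocalForm L 3 v))),
      ∀ t, ((eT t : ↥(borelU (conjLocal L (IsCMField.complexConj L) v) (cmLocalForm L 3 v))) :
        ↥(unitaryGroupOfForm (conjLocal L (IsCMField.complexConj L) v) (cmLocalForm L 3 v))) = t :=
    ⟨{ toFun := fun t => ⟨⟨t, torusU_le_borelU _ _ t.2⟩, Subgroup.mem_subgroupOf.2 t.2⟩
       invFun := fun x => ⟨x.1, Subgroup.mem_subgroupOf.1 x.2⟩
       left_inv := fun _ => rfl
       right_inv := fun _ => rfl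
       continuous_toFun := (continuous_subtype_val.subtype_mk _).subtype_mk _
       continuous_invFun := (continuous_subtype_val.comp continuous_subtype_val).subtype_mk _ }, fun _ => rfl⟩
  obtain ⟨eN, heN⟩ : ∃ eN : ↥(unipotentU (conjLocal L (IsCMField.complexConj L) v) (cmLocalForm L 3 v)) ≃ₜ
      ↥((unipotentU (conjLocal L (IsCMField.complexConj L) v) (cmLocalForm L 3 v)).subgroupOf
        (borelU (conjLocal L (IsCMField.complexConj L) v) (cmLocalForm L 3 v))),
      ∀ n, ((eN n : ↥(borelU (conjLocal L (IsCMField.complexConj L) v) (cmLocalForm L 3 v))) :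
        ↥(unitaryGroupOfForm (conjLocal L (IsCMField.complexConj L) v) (cmLocalForm L 3 v))) = n :=
    ⟨{ toFun := fun n => ⟨⟨n, unipotentU_le_borelU _ _ n.2⟩, Subgroup.mem_subgroupOf.2 n.2⟩
       invFun := fun x => ⟨x.1, Subgroup.mem_subgroupOf.1 x.2⟩
       left_inv := fun _ => rfl
       right_inv := fun _ => rfl
       continuous_toFun := (continuous_subtype_val.subtype_mk _).subtype_mk _
       continuous_invFun := (continuous_subtype_val.comp continuous_subtype_val).subtype_mk _ }, fun _ => rfl⟩
  obtain ⟨eB, heB⟩ : ∃ eB : ↥((torusU (conjLocal L (IsCMField.complexConj L) v) (cmLocalForm L 3 v)).subgroupOf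
        (borelU (conjLocal L (IsCMField.complexConj L) v) (cmLocalForm L 3 v))) ×
      ↥((unipotentU (conjLocal L (IsCMField.complexConj L) v) (cmLocalForm L 3 v)).subgroupOf
        (borelU (conjLocal L (IsCMField.complexConj L) v) (cmLocalForm L 3 v))) ≃ₜ
      ↥(borelU (conjLocal L (IsCMField.complexConj L) v) (cmLocalForm L 3 v)),
      ∀ q, eB q = (q.1 : ↥(borelU (conjLocal L (IsCMField.complexConj L) v) (cmLocalForm L 3 v))) * q.2 :=
    ⟨HeisRing.borelRingHomeomorph (conjLocal L (IsCMField.complexConj L) v) (cmLocalForm_eq_over L 3 v), fun _ => rfl⟩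
  refine ⟨(eT.prodCongr eN).trans eB, fun p => Subtype.ext ?_⟩
  have h1 : ((eT.prodCongr eN).trans eB) p = eB (eT p.1, eN p.2) := rfl
  rw [h1, heB, Subgroup.coe_mul, heT, heN, coe_anMap]

set_option maxHeartbeats 400000 in
/-- **The Iwasawa form of every invariant measure on `U(Φ₃)(L⁺_v) ⧸ T(L⁺_v)`** (★ Gelbart 9.22 (iii) `exists_measure_quotient_eq_smul_map` with ALL
its structural hypotheses DISCHARGED on the CM carrier: `T`, `B` closed ★, `T` normalises `N`, `T × N ≃ₜ B`, `G_v`, `T`, `N` unimodular ★ — and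
`G = K B` for any compact `K` the consumer supplies with that property, e.g. `K = K_v` by ★ `exists_mem_cmLocalIntegralLevel_mul_borel`):
`μ = C • ((k, n) ↦ k n T)_* (κ ⊗ μ_N)`, `C ≠ 0`. [cite: Gelbart1975, Thm. 9.22 (iii)] [cite: Rogawski1990, §4.13 p. 70] -/
theorem exists_measure_quotient_torusU_cmLocal_eq_smul_map
    [MeasurableSpace ↥(unitaryGroupOfForm (conjLocal L (IsCMField.complexConj L) v) (cmLocalForm L 3 v))]
    [BorelSpace ↥(unitaryGroupOfForm (conjLocal L (IsCMField.complexConj L) v) (cmLocalForm L 3 v))]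
    {K : Subgroup ↥(unitaryGroupOfForm (conjLocal L (IsCMField.complexConj L) v) (cmLocalForm L 3 v))}
    (hK : IsCompact (K : Set ↥(unitaryGroupOfForm (conjLocal L (IsCMField.complexConj L) v) (cmLocalForm L 3 v))))
    (hKB : ∀ g : ↥(unitaryGroupOfForm (conjLocal L (IsCMField.complexConj L) v) (cmLocalForm L 3 v)),
      ∃ k ∈ K, ∃ b ∈ borelU (conjLocal L (IsCMField.complexConj L) v) (cmLocalForm L 3 v), g = k * b)
    (κ : Measure ↥K) [IsHaarMeasure κ]
    (α : Measure ↥(torusU (conjLocal L (IsCMField.complexConj L) v) (cmLocalForm L 3 v))) [IsHaarMeasure α]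
    (μN : Measure ↥(unipotentU (conjLocal L (IsCMField.complexConj L) v) (cmLocalForm L 3 v))) [IsHaarMeasure μN]
    [MeasurableSpace (↥(unitaryGroupOfForm (conjLocal L (IsCMField.complexConj L) v) (cmLocalForm L 3 v)) ⧸
      torusU (conjLocal L (IsCMField.complexConj L) v) (cmLocalForm L 3 v))]
    [BorelSpace (↥(unitaryGroupOfForm (conjLocal L (IsCMField.complexConj L) v) (cmLocalForm L 3 v)) ⧸
      torusU (conjLocal L (IsCMField.complexConj L) v) (cmLocalForm L 3 v))]
    (μ : Measure (↥(unitaryGroupOfForm (conjLocal L (IsCMField.complexConj L) v) (cmLocalForm L 3 v)) ⧸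
      torusU (conjLocal L (IsCMField.complexConj L) v) (cmLocalForm L 3 v)))
    [SMulInvariantMeasure ↥(unitaryGroupOfForm (conjLocal L (IsCMField.complexConj L) v) (cmLocalForm L 3 v))
      (↥(unitaryGroupOfForm (conjLocal L (IsCMField.complexConj L) v) (cmLocalForm L 3 v)) ⧸
        torusU (conjLocal L (IsCMField.complexConj L) v) (cmLocalForm L 3 v)) μ]
    [IsFiniteMeasureOnCompacts μ] (hμ : μ ≠ 0) :
    ∃ C : ℝ≥0, C ≠ 0 ∧ μ = C • Measure.map
      (fun p : ↥K × ↥(unipotentU (conjLocal L (IsCMField.complexConj L) v) (cmLocalForm L 3 v)) =>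
        (QuotientGroup.mk ((p.1 : ↥(unitaryGroupOfForm (conjLocal L (IsCMField.complexConj L) v) (cmLocalForm L 3 v))) *
            (p.2 : ↥(unitaryGroupOfForm (conjLocal L (IsCMField.complexConj L) v) (cmLocalForm L 3 v)))) :
          ↥(unitaryGroupOfForm (conjLocal L (IsCMField.complexConj L) v) (cmLocalForm L 3 v)) ⧸
            torusU (conjLocal L (IsCMField.complexConj L) v) (cmLocalForm L 3 v)))
      (κ.prod μN) := by
  haveI : LocallyCompactSpace ↥(unitaryGroupOfForm (conjLocal L (IsCMField.complexConj L) v) (cmLocalForm L 3 v)) :=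
    locallyCompactSpace_local (IsCMField.complexConj L) 3 _ v
  haveI : SecondCountableTopology ↥(unitaryGroupOfForm (conjLocal L (IsCMField.complexConj L) v) (cmLocalForm L 3 v)) :=
    secondCountableTopology_local (IsCMField.complexConj L) 3 _ v
  have hT : IsClosed (torusU (conjLocal L (IsCMField.complexConj L) v) (cmLocalForm L 3 v) :
      Set ↥(unitaryGroupOfForm (conjLocal L (IsCMField.complexConj L) v) (cmLocalForm L 3 v))) := isClosed_cmBorelTriple_M L v
  have hN : IsClosed (unipotentU (conjLocal L (IsCMField.complexConj L) v) (cmLocalForm L 3 v) :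
      Set ↥(unitaryGroupOfForm (conjLocal L (IsCMField.complexConj L) v) (cmLocalForm L 3 v))) := isClosed_cmBorelTriple_N L v
  have hB : IsClosed (borelU (conjLocal L (IsCMField.complexConj L) v) (cmLocalForm L 3 v) :
      Set ↥(unitaryGroupOfForm (conjLocal L (IsCMField.complexConj L) v) (cmLocalForm L 3 v))) := isClosed_borelU _ _
  haveI : LocallyCompactSpace ↥(torusU (conjLocal L (IsCMField.complexConj L) v) (cmLocalForm L 3 v)) :=
    hT.isClosedEmbedding_subtypeVal.locallyCompactSpace
  haveI : LocallyCompactSpace ↥(unipotentU (conjLocal L (IsCMField.complexConj L) v) (cmLocalForm L 3 v)) :=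
    hN.isClosedEmbedding_subtypeVal.locallyCompactSpace
  haveI : LocallyCompactSpace ↥K := hK.isClosed.isClosedEmbedding_subtypeVal.locallyCompactSpace
  haveI : SecondCountableTopology ↥(torusU (conjLocal L (IsCMField.complexConj L) v) (cmLocalForm L 3 v)) :=
    TopologicalSpace.Subtype.secondCountableTopology _
  haveI : SecondCountableTopology ↥(unipotentU (conjLocal L (IsCMField.complexConj L) v) (cmLocalForm L 3 v)) :=
    TopologicalSpace.Subtype.secondCountableTopology _
  haveI : SecondCountableTopology ↥K := TopologicalSpace.Subtype.secondCountableTopology _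
  haveI : α.IsInvInvariant :=
    Literature.MeasureTheory.Group.isInvInvariant_of_comm _ hT (fun x hx y hy => mul_comm_of_mem_torusU_cmLocal L v hx hy) α
  haveI : μN.IsMulRightInvariant := isMulRightInvariant_cmBorelTriple_N L 3 v μN
  haveI : μN.IsInvInvariant := isInvInvariant_of_isMulRightInvariant μN
  obtain ⟨ν, hν⟩ : ∃ ν : Measure ↥(unitaryGroupOfForm (conjLocal L (IsCMField.complexConj L) v) (cmLocalForm L 3 v)),
      ν.IsHaarMeasure := ⟨Measure.haar, inferInstance⟩
  -- `U(Φ₃)(L⁺_v)` is unimodular (★ `modularCharacter_local_eq_one_of_isotropic`: `Φ₃` is hermitian, invertible, isotropic)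
  have hmod : ∀ g : ↥(unitaryGroupOfForm (conjLocal L (IsCMField.complexConj L) v) (cmLocalForm L 3 v)), modularCharacter g = 1 :=
    fun g => modularCharacter_local_eq_one_of_isotropic L (N := 3) (by norm_num) _ (antidiagOne_isHermitian L 3)
      (isUnit_antidiagOne_det L 3).ne_zero (antidiagOne_isotropic L (N := 3) (by norm_num)) v g
  haveI : ν.IsMulRightInvariant := isMulRightInvariant_of_modularCharacterFun_eq_one hmod ν
  haveI : ν.IsInvInvariant := isInvInvariant_of_isMulRightInvariant ν
  obtain ⟨e, he⟩ := exists_homeomorph_torusU_prod_unipotentU_cmLocal_eq_anMap L v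
  exact exists_measure_quotient_eq_smul_map hK hT hB (torusU_le_borelU _ _) (unipotentU_le_borelU _ _)
    (fun a ha n hn => conj_mem_unipotentU_cmLocal L v ha hn) e he hKB ν κ α μN μ hμ

/-- **TORUS DESCENT OF ORBITAL INTEGRALS ON `U(Φ₃)(L⁺_v)`, HYPOTHESIS-DRIVEN IN THE TWIST** (the non-split-place twin of ★
`GLnLeviOrbitalDescent`): once `μ = C • ((k, n) ↦ k n T)_* (κ ⊗ μ_N)` on `G_v ⧸ T` (★ `exists_measure_quotient_torusU_cmLocal_eq_smul_map` gives
such a `C ≠ 0` for EVERY non-zero invariant `μ`), for every `t ∈ T(L⁺_v)` whose twist on `N(L⁺_v)` has module `J` in the integral form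
`∫_N Φ(n t n⁻¹) dμ_N = J · ∫_N Φ(t n) dμ_N` (the PROPERTY binder `hJac`: for `t` regular `J = ‖D_{G∕T}(t)‖_v⁻¹`, [Rogawski1990 §7.3 p. 97,
Lemma 4.13.1 (a)] — the local twin of ★ `UnitaryGroupHeisenbergRegularTwistIntegral`, to be supplied on ★ `unipotentU` by the (L8a) programme)
and every Borel `F ≥ 0` on `G_v`:
**`∫_{G_v ⧸ T} F(y t y⁻¹) dμ(y) = C · J · ∫_{K × N} F(k (t n) k⁻¹) d(κ ⊗ μ_N)`**. [cite: Rogawski1990, §4.13 Lemma 4.13.1 (a) p. 64 and p. 70; §7.3 p. 97]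
[cite: Gelbart1975, Thm. 9.22 (iii)] -/
theorem lintegral_descConj_torusU_cmLocal_eq_mul_lintegral_prod
    [MeasurableSpace ↥(unitaryGroupOfForm (conjLocal L (IsCMField.complexConj L) v) (cmLocalForm L 3 v))]
    [BorelSpace ↥(unitaryGroupOfForm (conjLocal L (IsCMField.complexConj L) v) (cmLocalForm L 3 v))]
    {K : Subgroup ↥(unitaryGroupOfForm (conjLocal L (IsCMField.complexConj L) v) (cmLocalForm L 3 v))}
    (κ : Measure ↥K)
    (μN : Measure ↥(unipotentU (conjLocal L (IsCMField.complexConj L) v) (cmLocalForm L 3 v))) [SFinite μN]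
    [MeasurableSpace (↥(unitaryGroupOfForm (conjLocal L (IsCMField.complexConj L) v) (cmLocalForm L 3 v)) ⧸
      torusU (conjLocal L (IsCMField.complexConj L) v) (cmLocalForm L 3 v))]
    [BorelSpace (↥(unitaryGroupOfForm (conjLocal L (IsCMField.complexConj L) v) (cmLocalForm L 3 v)) ⧸
      torusU (conjLocal L (IsCMField.complexConj L) v) (cmLocalForm L 3 v))]
    (μ : Measure (↥(unitaryGroupOfForm (conjLocal L (IsCMField.complexConj L) v) (cmLocalForm L 3 v)) ⧸
      torusU (conjLocal L (IsCMField.complexConj L) v) (cmLocalForm L 3 v))) {C : ℝ≥0}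
    (hμC : μ = C • Measure.map
      (fun p : ↥K × ↥(unipotentU (conjLocal L (IsCMField.complexConj L) v) (cmLocalForm L 3 v)) =>
        (QuotientGroup.mk ((p.1 : ↥(unitaryGroupOfForm (conjLocal L (IsCMField.complexConj L) v) (cmLocalForm L 3 v))) *
            (p.2 : ↥(unitaryGroupOfForm (conjLocal L (IsCMField.complexConj L) v) (cmLocalForm L 3 v)))) :
          ↥(unitaryGroupOfForm (conjLocal L (IsCMField.complexConj L) v) (cmLocalForm L 3 v)) ⧸
            torusU (conjLocal L (IsCMField.complexConj L) v) (cmLocalForm L 3 v)))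
      (κ.prod μN))
    {t : ↥(unitaryGroupOfForm (conjLocal L (IsCMField.complexConj L) v) (cmLocalForm L 3 v))}
    (ht : t ∈ torusU (conjLocal L (IsCMField.complexConj L) v) (cmLocalForm L 3 v)) {J : ℝ≥0∞}
    (hJac : ∀ Φ : ↥(unitaryGroupOfForm (conjLocal L (IsCMField.complexConj L) v) (cmLocalForm L 3 v)) → ℝ≥0∞, Measurable Φ →
      ∫⁻ n, Φ ((n : ↥(unitaryGroupOfForm (conjLocal L (IsCMField.complexConj L) v) (cmLocalForm L 3 v))) * t *
          (n : ↥(unitaryGroupOfForm (conjLocal L (IsCMField.complexConj L) v) (cmLocalForm L 3 v)))⁻¹) ∂μN =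
        J * ∫⁻ n, Φ (t * (n : ↥(unitaryGroupOfForm (conjLocal L (IsCMField.complexConj L) v) (cmLocalForm L 3 v)))) ∂μN)
    {F : ↥(unitaryGroupOfForm (conjLocal L (IsCMField.complexConj L) v) (cmLocalForm L 3 v)) → ℝ≥0∞} (hF : Measurable F) :
    ∫⁻ y, descConj t (torusU (conjLocal L (IsCMField.complexConj L) v) (cmLocalForm L 3 v)) (forall_mem_torusU_cmLocal_comm L v ht) F y ∂μ =
      C * J * ∫⁻ p : ↥K × ↥(unipotentU (conjLocal L (IsCMField.complexConj L) v) (cmLocalForm L 3 v)),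
        F ((p.1 : ↥(unitaryGroupOfForm (conjLocal L (IsCMField.complexConj L) v) (cmLocalForm L 3 v))) *
          (t * (p.2 : ↥(unitaryGroupOfForm (conjLocal L (IsCMField.complexConj L) v) (cmLocalForm L 3 v)))) *
          (p.1 : ↥(unitaryGroupOfForm (conjLocal L (IsCMField.complexConj L) v) (cmLocalForm L 3 v)))⁻¹) ∂(κ.prod μN) := by
  haveI : LocallyCompactSpace ↥(unitaryGroupOfForm (conjLocal L (IsCMField.complexConj L) v) (cmLocalForm L 3 v)) :=
    locallyCompactSpace_local (IsCMField.complexConj L) 3 _ v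
  haveI : SecondCountableTopology ↥(unitaryGroupOfForm (conjLocal L (IsCMField.complexConj L) v) (cmLocalForm L 3 v)) :=
    secondCountableTopology_local (IsCMField.complexConj L) 3 _ v
  have hT : IsClosed (torusU (conjLocal L (IsCMField.complexConj L) v) (cmLocalForm L 3 v) :
      Set ↥(unitaryGroupOfForm (conjLocal L (IsCMField.complexConj L) v) (cmLocalForm L 3 v))) := isClosed_cmBorelTriple_M L v
  exact lintegral_descConj_eq_mul_lintegral_prod_torus_mul_unipotent_of_eq_smul_map hT κ μN μ hμC t
    (forall_mem_torusU_cmLocal_comm L v ht) hJac hF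

/-- **The unit orbital integral on `U(Φ₃)(L⁺_v) ⧸ T` descends to the constant term of the unit** (★ A-p06
`lintegral_prod_indicator_cmLocalIntegralLevel_conj_torus_mul_unipotent` by name): for `K ≤ K_v = U(Φ₃)(𝒪_v)` averaging, `t ∈ T(L⁺_v)` with twist
module `J`, and `μ = C • ((k, n) ↦ k n T)_* (κ ⊗ μ_N)`:
**`∫_{G_v ⧸ T} 1_{K_v}(y t y⁻¹) dμ(y) = C · J · κ(K) · μ_N(N ∩ K_v) · 1_{K_v}(t)`** — the `G`-side of the unit fundamental lemma
[Rogawski1990 Prop. 4.9.1 (b)] in the Levi ∕ constant-term case at a NON-SPLIT place, up to the measure dictionary `C` and the twist `J`.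
[cite: Rogawski1990, §4.9 Prop. 4.9.1 (b) p. 55; §4.13 p. 70] -/
theorem lintegral_descConj_indicator_cmLocalIntegralLevel_eq
    [MeasurableSpace ↥(unitaryGroupOfForm (conjLocal L (IsCMField.complexConj L) v) (cmLocalForm L 3 v))]
    [BorelSpace ↥(unitaryGroupOfForm (conjLocal L (IsCMField.complexConj L) v) (cmLocalForm L 3 v))]
    {K : Subgroup ↥(unitaryGroupOfForm (conjLocal L (IsCMField.complexConj L) v) (cmLocalForm L 3 v))}
    (hKv : ∀ k : ↥K, (k : ↥(unitaryGroupOfForm (conjLocal L (IsCMField.complexConj L) v) (cmLocalForm L 3 v))) ∈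
      cmLocalIntegralLevel L 3 (Matrix.of fun i j : Fin 3 => if i.val + j.val + 1 = 3 then (1 : L) else 0) v)
    (κ : Measure ↥K)
    (μN : Measure ↥(unipotentU (conjLocal L (IsCMField.complexConj L) v) (cmLocalForm L 3 v))) [SFinite μN]
    [MeasurableSpace (↥(unitaryGroupOfForm (conjLocal L (IsCMField.complexConj L) v) (cmLocalForm L 3 v)) ⧸
      torusU (conjLocal L (IsCMField.complexConj L) v) (cmLocalForm L 3 v))]
    [BorelSpace (↥(unitaryGroupOfForm (conjLocal L (IsCMField.complexConj L) v) (cmLocalForm L 3 v)) ⧸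
      torusU (conjLocal L (IsCMField.complexConj L) v) (cmLocalForm L 3 v))]
    (μ : Measure (↥(unitaryGroupOfForm (conjLocal L (IsCMField.complexConj L) v) (cmLocalForm L 3 v)) ⧸
      torusU (conjLocal L (IsCMField.complexConj L) v) (cmLocalForm L 3 v))) {C : ℝ≥0}
    (hμC : μ = C • Measure.map
      (fun p : ↥K × ↥(unipotentU (conjLocal L (IsCMField.complexConj L) v) (cmLocalForm L 3 v)) =>
        (QuotientGroup.mk ((p.1 : ↥(unitaryGroupOfForm (conjLocal L (IsCMField.complexConj L) v) (cmLocalForm L 3 v))) *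
            (p.2 : ↥(unitaryGroupOfForm (conjLocal L (IsCMField.complexConj L) v) (cmLocalForm L 3 v)))) :
          ↥(unitaryGroupOfForm (conjLocal L (IsCMField.complexConj L) v) (cmLocalForm L 3 v)) ⧸
            torusU (conjLocal L (IsCMField.complexConj L) v) (cmLocalForm L 3 v)))
      (κ.prod μN))
    {t : ↥(unitaryGroupOfForm (conjLocal L (IsCMField.complexConj L) v) (cmLocalForm L 3 v))}
    (ht : t ∈ torusU (conjLocal L (IsCMField.complexConj L) v) (cmLocalForm L 3 v)) {J : ℝ≥0∞}
    (hJac : ∀ Φ : ↥(unitaryGroupOfForm (conjLocal L (IsCMField.complexConj L) v) (cmLocalForm L 3 v)) → ℝ≥0∞, Measurable Φ →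
      ∫⁻ n, Φ ((n : ↥(unitaryGroupOfForm (conjLocal L (IsCMField.complexConj L) v) (cmLocalForm L 3 v))) * t *
          (n : ↥(unitaryGroupOfForm (conjLocal L (IsCMField.complexConj L) v) (cmLocalForm L 3 v)))⁻¹) ∂μN =
        J * ∫⁻ n, Φ (t * (n : ↥(unitaryGroupOfForm (conjLocal L (IsCMField.complexConj L) v) (cmLocalForm L 3 v)))) ∂μN) :
    ∫⁻ y, descConj t (torusU (conjLocal L (IsCMField.complexConj L) v) (cmLocalForm L 3 v)) (forall_mem_torusU_cmLocal_comm L v ht)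
        ({g : ↥(unitaryGroupOfForm (conjLocal L (IsCMField.complexConj L) v) (cmLocalForm L 3 v)) |
          g ∈ cmLocalIntegralLevel L 3 (Matrix.of fun i j : Fin 3 => if i.val + j.val + 1 = 3 then (1 : L) else 0) v}.indicator 1) y ∂μ =
      C * J * (κ univ *
        μN {u | (u : ↥(unitaryGroupOfForm (conjLocal L (IsCMField.complexConj L) v) (cmLocalForm L 3 v))) ∈
          cmLocalIntegralLevel L 3 (Matrix.of fun i j : Fin 3 => if i.val + j.val + 1 = 3 then (1 : L) else 0) v} *
        {g : ↥(unitaryGroupOfForm (conjLocal L (IsCMField.complexConj L) v) (cmLocalForm L 3 v)) |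
          g ∈ cmLocalIntegralLevel L 3 (Matrix.of fun i j : Fin 3 => if i.val + j.val + 1 = 3 then (1 : L) else 0) v}.indicator 1 t) := by
  have hO : IsOpen {g : ↥(unitaryGroupOfForm (conjLocal L (IsCMField.complexConj L) v) (cmLocalForm L 3 v)) |
      g ∈ cmLocalIntegralLevel L 3 (Matrix.of fun i j : Fin 3 => if i.val + j.val + 1 = 3 then (1 : L) else 0) v} :=
    (isCompact_isOpen_cmLocalIntegralLevel L 3 (Matrix.of fun i j : Fin 3 => if i.val + j.val + 1 = 3 then (1 : L) else 0) v).2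
  haveI : BorelSpace ↥(unipotentU (conjLocal L (IsCMField.complexConj L) v) (cmLocalForm L 3 v)) := Subtype.borelSpace _
  rw [lintegral_descConj_torusU_cmLocal_eq_mul_lintegral_prod L v κ μN μ hμC ht hJac (measurable_one.indicator hO.measurableSet),
    lintegral_prod_indicator_cmLocalIntegralLevel_conj_torus_mul_unipotent L 3 v κ
      (k := fun x : ↥K => (x : ↥(unitaryGroupOfForm (conjLocal L (IsCMField.complexConj L) v) (cmLocalForm L 3 v)))) hKv μN ht
      (measurableSet_setOf_coe_mem_cmLocalIntegralLevel L 3 v)]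

end UnitaryGroup

end Literature.NumberTheory.Automorphic

end
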